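import Summits.Ventures.CertifiedManyBodySolver.Upper.DWaveSourceOpenClusterCapTTPrime
import Summits.Ventures.CertifiedManyBodySolver.Observables.TISourcedClusterTrialRows
import Summits.Ventures.CertifiedManyBodySolver.Certificates.HubbardSquare_n7o8_lower_row504
import HarnessLib

/-!
# The `t–t′` twin of the cluster-rows bridge: open `t–t′` cluster states ⇒ tiled trial rows for
# `dWaveSourceTorusTT'` ⇒ translation-invariant states ⇒ canonical / grand-canonical `hcap` ⇒ chord floors,
# and the cuprate-anchor leaf `A0 = (U, n, t′) = (8, 7/8, −1/4)` on the booked lower node #504 BY NAME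

Cell hubbard-cq (rung CQ; lead 2026-08-26T20:08:29Z (2): «type (G) t′-GENERIC so A0 = (8, 7/8, −¼) is served the
day a sourced cap exists there; consumers are already t′-generic»). hubbard-obs-pin-1 g2 landed the producer
`Upper/DWaveSourceOpenClusterCapTTPrime.lean` (p470410): the open `a × b` `t–t′` cluster with the `d`-wave source
`A^{tt′}_C = dWaveSourceOpenBoxTT' a b tp U μ h = dWaveSourceOpenBox a b U μ h + hamiltonian (rectBoxDiagGraph a b) tp 0`
and `expect_prodFamily_dWaveSourceTorusTT'` (`⟨⊗_R φ, A^{tt′}_L ⊗_R φ⟩ = Kx Ky ⟨φ, A^{tt′}_C φ⟩` for an even unit `φ`,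
`L = Kx a = Ky b`, `a, b < L`; cross-block diagonal bonds vanish by parity). This file is the `t–t′` twin of
`TISourcedClusterTrialRows.lean` + `TISourcedClusterNodeFloorsU2.lean` §1:

* §1 `μ`-shift of the `t–t′` cluster; `tiledTrialRowsTT'_of_clusterState` (parity-`0` unit torus vectors with rows
  `Re⟨Ψ,NΨ⟩ = n·L²`, `Re⟨Ψ, A^{tt′}_L(U,μ,h)Ψ⟩ = e·L²` on every torus `q ∣ L`, `L ≥ L₀ > a, b`), the plain `hrows`
  shape, and the CERTIFICATE shape `hrowsTT'_mu_zero_of_clusterCap` (cap `≤ u·(ab)` at the cluster's `μ₀` + exact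
  number row ⇒ `μ = 0`-pencil cap rows `≤ (u + μ₀ n)·L²`).
* §2 the bridge composed at general `tp`: ONE cluster state ⇒ a translation-invariant state of density `n` with
  `E^{tp,μ}_h = e`; ONE certificate ⇒ the GC `hcap` at every `μ`; TWO certificates bracketing `n` ⇒ the canonical
  `hcap` (`exists_canonicalClass_sourced_le_of_two_clusterCapsTT'`).
* §3 the booked `4 × 3` NODE shape (real slots) at general `tp`: canonical `hcap`, and — with a certified canonical
  floor `lo ≤ e(1,tp,U,n)` — translation-invariant density-`n` minimisers of `E^{tp}_h` exist and every one has
  `(lo − u)/(2h) ≤ Re ω(P₀^d)` (`minimiser_response_floor_of_two_clusterNodesTT'_4x3`), `c·√2` form at `h = √2·g`.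
* §4 the A0 LEAF: the cell's lower node #504 (`Certificates.HubbardSquare_n7o8_lower_row504`,
  `cert_r504_… : ((−1008420703687177600106633/2⁸⁰ : ℚ) : ℝ) ≤ energyDensityTT' 1 (−1/4) 8 (7/8)`) taken BY NAME
  plus two `t′ = −1/4` cluster nodes with symbolic exact rows `(μᵢ, nᵢ, uᵢ)` ⇒ existence of translation-invariant
  density-`7/8` minimisers of `E^{−1/4}_h` and `(lo₅₀₄ − u)/(2h) ≤ Re ω(P₀^d)` for every one — the A0 floor reader,
  waiting only for a certified `t′ = −1/4` cluster cap (pilot-1 / var-10: operator `dWaveSourceOpenBoxTT' 4 3 (−1/4) 8 μ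
  (√2 g)`); and the `t′ = 0` twin on node #473 BY NAME (`…_of_cert473_…`, symbolic cluster rows).

HONEST FRAMING: soundness wrappers and CONDITIONAL large-field RESPONSE floors (hypotheses: a booked lower node and
two cluster certificate nodes); no number is produced here; a cap alone floors nothing; not an order parameter,
not a phase word, not a superconductivity verdict. Zero compute; no definition; no named fact; no `sorry`.
References: Ruelle, *Statistical Mechanics* (1969) §3.3–3.4 [Ruelle1969]; Bratteli–Robinson I (1987) §4.3.1
[BratteliRobinsonI1987]; Griffiths, Phys. Rev. 152 (1966) 240 §II [Griffiths1966]; Koma–Tasaki, J. Stat. Phys. 76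
(1994) 745 §1 [KomaTasaki1994]; Xu et al., Science 384 (2024) eadh7691, eq. (1) [XuEtAl2024].
-/

noncomputable section

namespace Summit.Ventures.CertifiedManyBodySolver.Observables

open Matrix Finset Literature.Probability.LatticeModels
open Literature.MathematicalPhysics.QuantumLattice Literature.MathematicalPhysics.QuantumLattice.ThermodynamicLimit
open Literature.MathematicalPhysics.QuantumLattice.TwoCluster
open TorusRectBlock ClusterParity Certificates
open scoped ComplexOrder

/-! ### §1 `μ`-shift of the `t–t′` cluster and the tiled trial rows for `dWaveSourceTorusTT'` -/

section Rows

variable {a b : ℕ}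

/-- **`μ`-shift of the open `t–t′` sourced cluster**: `A^{tt′}_C(μ′) = A^{tt′}_C(μ) + (μ − μ′)·N_C`.
[cite: KomaTasaki1994, §1] -/
theorem dWaveSourceOpenBoxTT'_mu_shift (a b : ℕ) (tp U μ μ' h : ℝ) :
    dWaveSourceOpenBoxTT' a b tp U μ' h = dWaveSourceOpenBoxTT' a b tp U μ h + ((μ - μ' : ℝ) : ℂ) • totalNumber := by
  rw [dWaveSourceOpenBoxTT', dWaveSourceOpenBoxTT', dWaveSourceOpenBox_mu_shift a b U μ μ' h]
  abel

/-- Real parts: `Re⟨ψ, A^{tt′}_C(μ′) ψ⟩ = Re⟨ψ, A^{tt′}_C(μ) ψ⟩ + (μ − μ′)·Re⟨ψ, N_C ψ⟩`. [cite: KomaTasaki1994, §1] -/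
theorem re_expect_dWaveSourceOpenBoxTT'_mu_shift (a b : ℕ) (tp U μ μ' h : ℝ) (ψ : Fock (Orb (Fin a ×ₗ Fin b))) :
    (star ψ ⬝ᵥ (dWaveSourceOpenBoxTT' a b tp U μ' h *ᵥ ψ)).re =
      (star ψ ⬝ᵥ (dWaveSourceOpenBoxTT' a b tp U μ h *ᵥ ψ)).re +
        (μ - μ') * (star ψ ⬝ᵥ (totalNumber *ᵥ ψ)).re := by
  rw [dWaveSourceOpenBoxTT'_mu_shift a b tp U μ μ' h]
  simp only [Matrix.add_mulVec, dotProduct_add, Matrix.smul_mulVec, dotProduct_smul, smul_eq_mul,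
    Complex.add_re, Complex.re_ofReal_mul]

/-- **Trial rows of the tiled product on one torus, `t–t′` model** (`L = Kx a = Ky b`, `a, b < L`): an even unit
cluster vector with exact rows `Re⟨ψ, N_C ψ⟩ = n·(ab)`, `Re⟨ψ, A^{tt′}_C(U,μ,h) ψ⟩ = e·(ab)` gives a parity-`0` unit
torus vector with `Re⟨Ψ, NΨ⟩ = n·L²` and `Re⟨Ψ, A^{tt′}_L(U,μ,h)Ψ⟩ = e·L²`. [cite: Ruelle1969, §3.3] -/
theorem exists_tiledTrialVectorTT' {L Kx Ky : ℕ} [NeZero L] (hLa : L = Kx * a) (hLb : L = Ky * b)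
    (haL : a < L) (hbL : b < L) (tp U μ h : ℝ) {ψ : Fock (Orb (Fin a ×ₗ Fin b))} (hψ : HasParity 0 ψ)
    (hψ1 : star ψ ⬝ᵥ ψ = 1) {n e : ℝ}
    (hN : (star ψ ⬝ᵥ (totalNumber *ᵥ ψ)).re = n * ((a : ℝ) * b))
    (hE : (star ψ ⬝ᵥ (dWaveSourceOpenBoxTT' a b tp U μ h *ᵥ ψ)).re = e * ((a : ℝ) * b)) :
    ∃ Ψ : Fock (Orb (FermionTorus 2 L)), HasParity 0 Ψ ∧ star Ψ ⬝ᵥ Ψ = 1 ∧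
      (expect totalNumber Ψ).re = n * (L : ℝ) ^ 2 ∧
        (expect (dWaveSourceTorusTT' L tp U μ h) Ψ).re = e * (L : ℝ) ^ 2 := by
  have hL2 : ((L : ℝ)) ^ 2 = ((Kx * Ky : ℕ) : ℝ) * ((a : ℝ) * b) := by
    rw [sq]
    nth_rewrite 1 [hLa]
    rw [hLb]
    push_cast
    ring
  have hcast : ((Kx * Ky : ℕ) : ℂ) = (((Kx * Ky : ℕ) : ℝ) : ℂ) := by norm_cast
  refine ⟨(rectBlockPartition hLa hLb).prodFamily fun _ => ψ, hasParity_zero_prodFamily hLa hLb hψ,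
    star_prodFamily_dotProduct_self_eq_one hLa hLb hψ1, ?_, ?_⟩
  · rw [Literature.MathematicalPhysics.QuantumLattice.expect,
      Observables.expect_prodFamily_totalNumber hLa hLb haL hbL U μ h hψ hψ1, hcast, Complex.re_ofReal_mul, hN, hL2]
    ring
  · rw [Literature.MathematicalPhysics.QuantumLattice.expect,
      expect_prodFamily_dWaveSourceTorusTT' hLa hLb haL hbL tp U μ h hψ hψ1, hcast, Complex.re_ofReal_mul, hE, hL2]
    ring

/-- **The `hrows` slot at general `tp` from ONE even unit cluster vector** (parity kept): for `a ∣ q`, `b ∣ q`,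
`L₀ > a, b`, exact cluster rows `(n, e)` at `(tp, U, μ, h)` give on every torus `q ∣ L`, `L ≥ L₀` a parity-`0` unit
vector with rows `Re⟨Ψ,NΨ⟩ = n·L²`, `Re⟨Ψ, dWaveSourceTorusTT' L tp U μ h Ψ⟩ = e·L²`. [cite: Ruelle1969, §3.3] -/
theorem tiledTrialRowsTT'_of_clusterState {q L₀ : ℕ} (hqa : a ∣ q) (hqb : b ∣ q) (hLa0 : a < L₀)
    (hLb0 : b < L₀) (tp U μ h : ℝ) {ψ : Fock (Orb (Fin a ×ₗ Fin b))} (hψ : HasParity 0 ψ)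
    (hψ1 : star ψ ⬝ᵥ ψ = 1) {n e : ℝ}
    (hN : (star ψ ⬝ᵥ (totalNumber *ᵥ ψ)).re = n * ((a : ℝ) * b))
    (hE : (star ψ ⬝ᵥ (dWaveSourceOpenBoxTT' a b tp U μ h *ᵥ ψ)).re = e * ((a : ℝ) * b)) :
    ∀ L : ℕ, q ∣ L → L₀ ≤ L → ∀ [NeZero L], ∃ Ψ : Fock (Orb (FermionTorus 2 L)),
      HasParity 0 Ψ ∧ star Ψ ⬝ᵥ Ψ = 1 ∧ (expect totalNumber Ψ).re = n * (L : ℝ) ^ 2 ∧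
        (expect (dWaveSourceTorusTT' L tp U μ h) Ψ).re = e * (L : ℝ) ^ 2 := by
  intro L hqL hL _
  obtain ⟨Kx, hKx⟩ := hqa.trans hqL
  obtain ⟨Ky, hKy⟩ := hqb.trans hqL
  exact exists_tiledTrialVectorTT' (by rw [hKx, mul_comm]) (by rw [hKy, mul_comm]) (lt_of_lt_of_le hLa0 hL)
    (lt_of_lt_of_le hLb0 hL) tp U μ h hψ hψ1 hN hE

/-- **The plain `hrows` shape at general `tp`** (parity dropped) — literally the hypothesis of
`exists_isTranslationInvariant_density_eq_meanEnergy_sourced_eq_of_periodic_trialStates`. [cite: Ruelle1969, §3.3] -/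
theorem hrowsTT'_of_clusterState {q L₀ : ℕ} (hqa : a ∣ q) (hqb : b ∣ q) (hLa0 : a < L₀) (hLb0 : b < L₀)
    (tp U μ h : ℝ) {ψ : Fock (Orb (Fin a ×ₗ Fin b))} (hψ : HasParity 0 ψ) (hψ1 : star ψ ⬝ᵥ ψ = 1) {n e : ℝ}
    (hN : (star ψ ⬝ᵥ (totalNumber *ᵥ ψ)).re = n * ((a : ℝ) * b))
    (hE : (star ψ ⬝ᵥ (dWaveSourceOpenBoxTT' a b tp U μ h *ᵥ ψ)).re = e * ((a : ℝ) * b)) :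
    ∀ L : ℕ, q ∣ L → L₀ ≤ L → ∀ [NeZero L], ∃ Ψ : Fock (Orb (FermionTorus 2 L)),
      star Ψ ⬝ᵥ Ψ = 1 ∧ (expect totalNumber Ψ).re = n * (L : ℝ) ^ 2 ∧
        (expect (dWaveSourceTorusTT' L tp U μ h) Ψ).re = e * (L : ℝ) ^ 2 := by
  intro L hqL hL _
  obtain ⟨Ψ, -, h1, h2, h3⟩ := tiledTrialRowsTT'_of_clusterState hqa hqb hLa0 hLb0 tp U μ h hψ hψ1 hN hE L hqL hL
  exact ⟨Ψ, h1, h2, h3⟩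

/-- **CERTIFICATE shape ⇒ `μ = 0`-pencil CAP rows at general `tp`.** An even unit cluster vector with exact number
row `n·(ab)` and an energy CAP `Re⟨ψ, A^{tt′}_C(U,μ₀,h) ψ⟩ ≤ u·(ab)` at the cluster's own `μ₀` gives on every
admissible torus a unit vector with `Re⟨Ψ,NΨ⟩ = n·L²` and `Re⟨Ψ, dWaveSourceTorusTT' L tp U 0 h Ψ⟩ ≤ (u + μ₀·n)·L²`.
[cite: KomaTasaki1994, §1] [cite: Ruelle1969, §3.3] -/
theorem hrowsTT'_mu_zero_of_clusterCap {q L₀ : ℕ} (hqa : a ∣ q) (hqb : b ∣ q) (hLa0 : a < L₀) (hLb0 : b < L₀)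
    (tp U μ₀ h : ℝ) {ψ : Fock (Orb (Fin a ×ₗ Fin b))} (hψ : HasParity 0 ψ) (hψ1 : star ψ ⬝ᵥ ψ = 1) {n u : ℝ}
    (hN : (star ψ ⬝ᵥ (totalNumber *ᵥ ψ)).re = n * ((a : ℝ) * b))
    (hE : (star ψ ⬝ᵥ (dWaveSourceOpenBoxTT' a b tp U μ₀ h *ᵥ ψ)).re ≤ u * ((a : ℝ) * b)) :
    ∀ L : ℕ, q ∣ L → L₀ ≤ L → ∀ [NeZero L], ∃ Ψ : Fock (Orb (FermionTorus 2 L)),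
      star Ψ ⬝ᵥ Ψ = 1 ∧ (expect totalNumber Ψ).re = n * (L : ℝ) ^ 2 ∧
        (expect (dWaveSourceTorusTT' L tp U 0 h) Ψ).re ≤ (u + μ₀ * n) * (L : ℝ) ^ 2 := by
  intro L hqL hL _
  have ha : (0 : ℝ) < a := Nat.cast_pos.2 (Nat.pos_of_dvd_of_pos (hqa.trans hqL) (NeZero.pos L))
  have hb : (0 : ℝ) < b := Nat.cast_pos.2 (Nat.pos_of_dvd_of_pos (hqb.trans hqL) (NeZero.pos L))
  have hab : (0 : ℝ) < (a : ℝ) * b := mul_pos ha hb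
  set e₀ : ℝ := (star ψ ⬝ᵥ (dWaveSourceOpenBoxTT' a b tp U 0 h *ᵥ ψ)).re / ((a : ℝ) * b) with he₀
  have hE0 : (star ψ ⬝ᵥ (dWaveSourceOpenBoxTT' a b tp U 0 h *ᵥ ψ)).re = e₀ * ((a : ℝ) * b) := by
    rw [he₀, div_mul_cancel₀ _ hab.ne']
  have hshift := re_expect_dWaveSourceOpenBoxTT'_mu_shift a b tp U μ₀ 0 h ψ
  have hle : e₀ ≤ u + μ₀ * n := by
    have h1 : e₀ * ((a : ℝ) * b) ≤ (u + μ₀ * n) * ((a : ℝ) * b) := by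
      rw [← hE0, hshift, sub_zero, hN, add_mul]
      nlinarith [hE]
    exact le_of_mul_le_mul_right h1 hab
  obtain ⟨Ψ, h1, h2, h3⟩ := hrowsTT'_of_clusterState hqa hqb hLa0 hLb0 tp U 0 h hψ hψ1 hN hE0 L hqL hL
  refine ⟨Ψ, h1, h2, ?_⟩
  rw [h3]
  exact mul_le_mul_of_nonneg_right hle (by positivity)

end Rows

/-! ### §2 The bridge composed at general `tp`: cluster states ⇒ translation-invariant states -/

section Bridge

variable {a b : ℕ}

/-- **ONE even unit `t–t′` cluster vector ⇒ a translation-invariant state of density `n` and sourced mean energy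
`e` for `hubbardTTPrimeSourcedInteraction 1 tp U μ dWaveFormFactor h`.** [cite: BratteliRobinsonI1987, §4.3.1] -/
theorem exists_isTranslationInvariant_of_clusterStateTT' (ha : 0 < a) (hb : 0 < b) (tp U μ h : ℝ)
    {ψ : Fock (Orb (Fin a ×ₗ Fin b))} (hψ : HasParity 0 ψ) (hψ1 : star ψ ⬝ᵥ ψ = 1) {n e : ℝ}
    (hN : (star ψ ⬝ᵥ (totalNumber *ᵥ ψ)).re = n * ((a : ℝ) * b))
    (hE : (star ψ ⬝ᵥ (dWaveSourceOpenBoxTT' a b tp U μ h *ᵥ ψ)).re = e * ((a : ℝ) * b)) :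
    ∃ σ : InfVolFermionState 2, σ.IsTranslationInvariant ∧ σ.density = n ∧
      σ.meanEnergy (hubbardTTPrimeSourcedInteraction 1 tp U μ dWaveFormFactor h) 1 = e :=
  exists_isTranslationInvariant_density_eq_meanEnergy_sourced_eq_of_periodic_trialStates tp U μ h
    (Nat.mul_pos ha hb) (a + b + 1)
    (hrowsTT'_of_clusterState (Dvd.intro b rfl) (Dvd.intro_left a rfl) (by omega) (by omega) tp U μ h hψ hψ1 hN hE)

/-- **ONE `t–t′` cluster CERTIFICATE (cap at `μ₀`, exact number row, `n ∈ (0,2)`) ⇒ the grand-canonical `hcap` at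
EVERY `μ`**: SOME translation-invariant state with density in `(0,2)` has `E^{tp,μ}_h ≤ u + (μ₀ − μ)·n`.
[cite: BratteliRobinsonI1987, §4.3.1] -/
theorem exists_gcClass_sourced_le_of_clusterCapTT' (ha : 0 < a) (hb : 0 < b) (tp U μ₀ μ h : ℝ)
    {ψ : Fock (Orb (Fin a ×ₗ Fin b))} (hψ : HasParity 0 ψ) (hψ1 : star ψ ⬝ᵥ ψ = 1) {n u : ℝ}
    (hN : (star ψ ⬝ᵥ (totalNumber *ᵥ ψ)).re = n * ((a : ℝ) * b))
    (hE : (star ψ ⬝ᵥ (dWaveSourceOpenBoxTT' a b tp U μ₀ h *ᵥ ψ)).re ≤ u * ((a : ℝ) * b)) (hn0 : 0 < n)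
    (hn2 : n < 2) :
    ∃ σ : InfVolFermionState 2, σ.IsTranslationInvariant ∧ 0 < σ.density ∧ σ.density < 2 ∧
      σ.meanEnergy (hubbardTTPrimeSourcedInteraction 1 tp U μ dWaveFormFactor h) 1 ≤ u + (μ₀ - μ) * n := by
  obtain ⟨σ, hσ, hρ, hEσ⟩ :=
    exists_isTranslationInvariant_density_eq_meanEnergy_sourced_le_of_periodic_trialStates tp U 0 h
      (Nat.mul_pos ha hb) (a + b + 1)
      (hrowsTT'_mu_zero_of_clusterCap (Dvd.intro b rfl) (Dvd.intro_left a rfl) (by omega) (by omega) tp U μ₀ h hψ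
        hψ1 hN hE)
  refine ⟨σ, hσ, hρ.symm ▸ hn0, hρ.symm ▸ hn2, ?_⟩
  rw [meanEnergy_hubbardTTPrimeSourced_mu_eq σ hρ]
  linarith

/-- **TWO `t–t′` cluster CERTIFICATES bracketing the density ⇒ the canonical-class `hcap` at general `tp`.** Even
unit cluster vectors `ψ₁, ψ₂` (boxes `a₁ × b₁`, `a₂ × b₂`) with exact number rows `nᵢ·(aᵢbᵢ)`, energy caps
`≤ uᵢ·(aᵢbᵢ)` at their own `μᵢ`, densities `n₁ < n₂` bracketing `n`, and the side condition
`(n₂ − n)·(u₁ + μ₁n₁) + (n − n₁)·(u₂ + μ₂n₂) ≤ u·(n₂ − n₁)`: SOME translation-invariant state of density EXACTLY `n`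
has `E^{tp}_h ≤ u` on the `μ = 0` pencil. [cite: BratteliRobinsonI1987, §4.3.1] -/
theorem exists_canonicalClass_sourced_le_of_two_clusterCapsTT' {a₁ b₁ a₂ b₂ : ℕ} (ha₁ : 0 < a₁) (hb₁ : 0 < b₁)
    (ha₂ : 0 < a₂) (hb₂ : 0 < b₂) (tp U μ₁ μ₂ h : ℝ)
    {ψ₁ : Fock (Orb (Fin a₁ ×ₗ Fin b₁))} (hψ₁ : HasParity 0 ψ₁) (h1₁ : star ψ₁ ⬝ᵥ ψ₁ = 1)
    {ψ₂ : Fock (Orb (Fin a₂ ×ₗ Fin b₂))} (hψ₂ : HasParity 0 ψ₂) (h1₂ : star ψ₂ ⬝ᵥ ψ₂ = 1)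
    {n₁ n₂ n u₁ u₂ u : ℝ}
    (hN₁ : (star ψ₁ ⬝ᵥ (totalNumber *ᵥ ψ₁)).re = n₁ * ((a₁ : ℝ) * b₁))
    (hE₁ : (star ψ₁ ⬝ᵥ (dWaveSourceOpenBoxTT' a₁ b₁ tp U μ₁ h *ᵥ ψ₁)).re ≤ u₁ * ((a₁ : ℝ) * b₁))
    (hN₂ : (star ψ₂ ⬝ᵥ (totalNumber *ᵥ ψ₂)).re = n₂ * ((a₂ : ℝ) * b₂))
    (hE₂ : (star ψ₂ ⬝ᵥ (dWaveSourceOpenBoxTT' a₂ b₂ tp U μ₂ h *ᵥ ψ₂)).re ≤ u₂ * ((a₂ : ℝ) * b₂))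
    (hlt : n₁ < n₂) (hle₁ : n₁ ≤ n) (hle₂ : n ≤ n₂)
    (hu : (n₂ - n) * (u₁ + μ₁ * n₁) + (n - n₁) * (u₂ + μ₂ * n₂) ≤ u * (n₂ - n₁)) :
    ∃ σ : InfVolFermionState 2, σ.IsTranslationInvariant ∧ σ.density = n ∧
      σ.meanEnergy (hubbardTTPrimeSourcedInteraction 1 tp U 0 dWaveFormFactor h) 1 ≤ u :=
  exists_isTranslationInvariant_density_eq_meanEnergy_sourced_le_of_two_periodic_trialCaps tp U 0 h
    (Nat.mul_pos ha₁ hb₁) (Nat.mul_pos ha₂ hb₂) (a₁ + b₁ + 1) (a₂ + b₂ + 1)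
    (hrowsTT'_mu_zero_of_clusterCap (Dvd.intro b₁ rfl) (Dvd.intro_left a₁ rfl) (by omega) (by omega) tp U μ₁ h hψ₁
      h1₁ hN₁ hE₁)
    (hrowsTT'_mu_zero_of_clusterCap (Dvd.intro b₂ rfl) (Dvd.intro_left a₂ rfl) (by omega) (by omega) tp U μ₂ h hψ₂
      h1₂ hN₂ hE₂)
    hlt hle₁ hle₂ hu

end Bridge

/-! ### §3 The booked `4 × 3` NODE shape at general `tp`: canonical `hcap` and the minimiser floors -/

section Nodes

variable {ω : InfVolFermionState 2} {tp U μ₁ μ₂ h g n n₁ n₂ u₁ u₂ u lo c : ℝ}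

/-- **Two `4 × 3` `t–t′` cluster NODES bracketing the density ⇒ the canonical-class `hcap`** (real slots).
[cite: BratteliRobinsonI1987, §4.3.1] -/
theorem exists_canonicalClass_sourced_le_of_two_clusterNodesTT'_4x3 (tp U μ₁ μ₂ h : ℝ)
    (hC₁ : ∃ ψ : Fock (Orb (Fin 4 ×ₗ Fin 3)), HasParity 0 ψ ∧ star ψ ⬝ᵥ ψ = 1 ∧
      (star ψ ⬝ᵥ (totalNumber *ᵥ ψ)).re = n₁ * ((4 : ℝ) * 3) ∧
      (star ψ ⬝ᵥ (dWaveSourceOpenBoxTT' 4 3 tp U μ₁ h *ᵥ ψ)).re ≤ u₁ * ((4 : ℝ) * 3))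
    (hC₂ : ∃ ψ : Fock (Orb (Fin 4 ×ₗ Fin 3)), HasParity 0 ψ ∧ star ψ ⬝ᵥ ψ = 1 ∧
      (star ψ ⬝ᵥ (totalNumber *ᵥ ψ)).re = n₂ * ((4 : ℝ) * 3) ∧
      (star ψ ⬝ᵥ (dWaveSourceOpenBoxTT' 4 3 tp U μ₂ h *ᵥ ψ)).re ≤ u₂ * ((4 : ℝ) * 3))
    (hlt : n₁ < n₂) (hle₁ : n₁ ≤ n) (hle₂ : n ≤ n₂)
    (hu : (n₂ - n) * (u₁ + μ₁ * n₁) + (n - n₁) * (u₂ + μ₂ * n₂) ≤ u * (n₂ - n₁)) :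
    ∃ σ : InfVolFermionState 2, σ.IsTranslationInvariant ∧ σ.density = n ∧
      σ.meanEnergy (hubbardTTPrimeSourcedInteraction 1 tp U 0 dWaveFormFactor h) 1 ≤ u := by
  obtain ⟨ψ₁, hψ₁, h1₁, hN₁, hE₁⟩ := hC₁
  obtain ⟨ψ₂, hψ₂, h1₂, hN₂, hE₂⟩ := hC₂
  have h4 : ((4 : ℕ) : ℝ) = 4 := by norm_num
  have h3 : ((3 : ℕ) : ℝ) = 3 := by norm_num
  exact exists_canonicalClass_sourced_le_of_two_clusterCapsTT' (by norm_num) (by norm_num) (by norm_num) (by norm_num)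
    tp U μ₁ μ₂ h hψ₁ h1₁ hψ₂ h1₂ (by rw [h4, h3]; exact hN₁) (by rw [h4, h3]; exact hE₁) (by rw [h4, h3]; exact hN₂)
    (by rw [h4, h3]; exact hE₂) hlt hle₁ hle₂ hu

/-- **`t–t′` B1/A0 chain from two `4 × 3` nodes** (real slots): `U ≥ 0`, `h > 0`, `n ∈ (0,2)`, a certified canonical
floor `lo ≤ e(1,tp,U,n)` and the two nodes give: translation-invariant density-`n` minimisers of `E^{tp}_h` EXIST
and EVERY one has `(lo − u)/(2h) ≤ Re ω(P₀^d)`. CONDITIONAL on the rows; a RESPONSE floor, not an order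
parameter. [cite: Griffiths1966, §II] [cite: KomaTasaki1994, §1] -/
theorem minimiser_response_floor_of_two_clusterNodesTT'_4x3 (hU : 0 ≤ U) (hh : 0 < h) (hn0 : 0 < n)
    (hn2 : n < 2) (hlo : lo ≤ energyDensityTT' 1 tp U n)
    (hC₁ : ∃ ψ : Fock (Orb (Fin 4 ×ₗ Fin 3)), HasParity 0 ψ ∧ star ψ ⬝ᵥ ψ = 1 ∧
      (star ψ ⬝ᵥ (totalNumber *ᵥ ψ)).re = n₁ * ((4 : ℝ) * 3) ∧
      (star ψ ⬝ᵥ (dWaveSourceOpenBoxTT' 4 3 tp U μ₁ h *ᵥ ψ)).re ≤ u₁ * ((4 : ℝ) * 3))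
    (hC₂ : ∃ ψ : Fock (Orb (Fin 4 ×ₗ Fin 3)), HasParity 0 ψ ∧ star ψ ⬝ᵥ ψ = 1 ∧
      (star ψ ⬝ᵥ (totalNumber *ᵥ ψ)).re = n₂ * ((4 : ℝ) * 3) ∧
      (star ψ ⬝ᵥ (dWaveSourceOpenBoxTT' 4 3 tp U μ₂ h *ᵥ ψ)).re ≤ u₂ * ((4 : ℝ) * 3))
    (hlt : n₁ < n₂) (hle₁ : n₁ ≤ n) (hle₂ : n ≤ n₂)
    (hu : (n₂ - n) * (u₁ + μ₁ * n₁) + (n - n₁) * (u₂ + μ₂ * n₂) ≤ u * (n₂ - n₁)) :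
    (∃ ω : InfVolFermionState 2, ω.IsTranslationInvariant ∧ ω.density = n ∧
      ∀ ω' : InfVolFermionState 2, ω'.IsTranslationInvariant → ω'.density = n →
        ω.meanEnergy (hubbardTTPrimeSourcedInteraction 1 tp U 0 dWaveFormFactor h) 1 ≤
          ω'.meanEnergy (hubbardTTPrimeSourcedInteraction 1 tp U 0 dWaveFormFactor h) 1) ∧
    ∀ ω : InfVolFermionState 2, ω.IsTranslationInvariant → ω.density = n →
      (∀ ω' : InfVolFermionState 2, ω'.IsTranslationInvariant → ω'.density = n →
        ω.meanEnergy (hubbardTTPrimeSourcedInteraction 1 tp U 0 dWaveFormFactor h) 1 ≤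
          ω'.meanEnergy (hubbardTTPrimeSourcedInteraction 1 tp U 0 dWaveFormFactor h) 1) →
      (lo - u) / (2 * h) ≤
        (ω.expect (pairRegion (insert 0 unitSteps) 0) (localPairAt (insert 0 unitSteps) dWaveFormFactor 0)).re :=
  ⟨exists_minimiser_canonicalClass _ hn0.le hn2, fun _ hω hρ hmin =>
    re_expect_localPairAt_ge_of_minimiser hω hU hρ hn0 hn2 hh hlo hmin
      (exists_canonicalClass_sourced_le_of_two_clusterNodesTT'_4x3 tp U μ₁ μ₂ h hC₁ hC₂ hlt hle₁ hle₂ hu)⟩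

/-- The `c·√2` form at `h = √2·g`: `c·(4g) ≤ lo − u` gives `c·√2 ≤ (lo − u)/(2·(√2·g))`. [folklore] -/
private theorem mul_sqrt_two_le_chord' (hg : 0 < g) (hc : c * (4 * g) ≤ lo - u) :
    c * Real.sqrt 2 ≤ (lo - u) / (2 * (Real.sqrt 2 * g)) := by
  have h2 : Real.sqrt 2 * Real.sqrt 2 = 2 := Real.mul_self_sqrt (by norm_num)
  rw [le_div_iff₀ (by positivity)]
  calc c * Real.sqrt 2 * (2 * (Real.sqrt 2 * g)) = c * (Real.sqrt 2 * Real.sqrt 2) * (2 * g) := by ring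
    _ = c * (4 * g) := by rw [h2]; ring
    _ ≤ lo - u := hc

/-- **`t–t′` chain at `h = √2·g`, `c·√2` form**: with `c·(4g) ≤ lo − u`, density-`n` minimisers of `E^{tp}_{√2 g}` exist
and every one has `c·√2 ≤ Re ω(P₀^d)`. [cite: Griffiths1966, §II] -/
theorem minimiser_response_floor_sqrt_two_of_two_clusterNodesTT'_4x3 (hU : 0 ≤ U) (hg : 0 < g) (hn0 : 0 < n)
    (hn2 : n < 2) (hlo : lo ≤ energyDensityTT' 1 tp U n)
    (hC₁ : ∃ ψ : Fock (Orb (Fin 4 ×ₗ Fin 3)), HasParity 0 ψ ∧ star ψ ⬝ᵥ ψ = 1 ∧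
      (star ψ ⬝ᵥ (totalNumber *ᵥ ψ)).re = n₁ * ((4 : ℝ) * 3) ∧
      (star ψ ⬝ᵥ (dWaveSourceOpenBoxTT' 4 3 tp U μ₁ (Real.sqrt 2 * g) *ᵥ ψ)).re ≤ u₁ * ((4 : ℝ) * 3))
    (hC₂ : ∃ ψ : Fock (Orb (Fin 4 ×ₗ Fin 3)), HasParity 0 ψ ∧ star ψ ⬝ᵥ ψ = 1 ∧
      (star ψ ⬝ᵥ (totalNumber *ᵥ ψ)).re = n₂ * ((4 : ℝ) * 3) ∧
      (star ψ ⬝ᵥ (dWaveSourceOpenBoxTT' 4 3 tp U μ₂ (Real.sqrt 2 * g) *ᵥ ψ)).re ≤ u₂ * ((4 : ℝ) * 3))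
    (hlt : n₁ < n₂) (hle₁ : n₁ ≤ n) (hle₂ : n ≤ n₂)
    (hu : (n₂ - n) * (u₁ + μ₁ * n₁) + (n - n₁) * (u₂ + μ₂ * n₂) ≤ u * (n₂ - n₁))
    (hc : c * (4 * g) ≤ lo - u) :
    (∃ ω : InfVolFermionState 2, ω.IsTranslationInvariant ∧ ω.density = n ∧
      ∀ ω' : InfVolFermionState 2, ω'.IsTranslationInvariant → ω'.density = n →
        ω.meanEnergy (hubbardTTPrimeSourcedInteraction 1 tp U 0 dWaveFormFactor (Real.sqrt 2 * g)) 1 ≤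
          ω'.meanEnergy (hubbardTTPrimeSourcedInteraction 1 tp U 0 dWaveFormFactor (Real.sqrt 2 * g)) 1) ∧
    ∀ ω : InfVolFermionState 2, ω.IsTranslationInvariant → ω.density = n →
      (∀ ω' : InfVolFermionState 2, ω'.IsTranslationInvariant → ω'.density = n →
        ω.meanEnergy (hubbardTTPrimeSourcedInteraction 1 tp U 0 dWaveFormFactor (Real.sqrt 2 * g)) 1 ≤
          ω'.meanEnergy (hubbardTTPrimeSourcedInteraction 1 tp U 0 dWaveFormFactor (Real.sqrt 2 * g)) 1) →
      c * Real.sqrt 2 ≤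
        (ω.expect (pairRegion (insert 0 unitSteps) 0) (localPairAt (insert 0 unitSteps) dWaveFormFactor 0)).re := by
  obtain ⟨hex, hall⟩ := minimiser_response_floor_of_two_clusterNodesTT'_4x3 hU
    (by positivity : 0 < Real.sqrt 2 * g) hn0 hn2 hlo hC₁ hC₂ hlt hle₁ hle₂ hu
  exact ⟨hex, fun ω hω hρ hmin => (mul_sqrt_two_le_chord' hg hc).trans (hall ω hω hρ hmin)⟩

end Nodes

/-! ### §4 The anchors BY NAME: A0 = (8, 7/8, −1/4) on node #504, B1 = (8, 7/8, 0) on node #473 -/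

section Anchors

variable {μ₁ μ₂ h n₁ n₂ u₁ u₂ u : ℝ}

/-- **A0 floor reader** (`(U, n, t′) = (8, 7/8, −1/4)`): the booked lower node #504
(`cert_r504_… : lo₅₀₄ ≤ e(1,−1/4,8,7/8)`, `lo₅₀₄ = −1008420703687177600106633/2⁸⁰ ≈ −0.8341461`) BY NAME and two
`t′ = −1/4` `4 × 3` cluster nodes with exact rows `(μᵢ, nᵢ, uᵢ)` (`n₁ < n₂` bracketing `7/8`, side condition with the
canonical cap `u`) give: translation-invariant density-`7/8` minimisers of `E^{−1/4}_h` EXIST and EVERY one has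
`(lo₅₀₄ − u)/(2h) ≤ Re ω(P₀^d)`. CONDITIONAL on the three nodes; positive iff the certified pinning gain `lo₅₀₄ − u`
is; a RESPONSE floor at field `h`, not an order parameter, no phase word. [cite: Griffiths1966, §II] -/
theorem minimiser_response_floor_A0_of_cert504_of_two_clusterNodesTT' (hh : 0 < h)
    (h504 : cert_r504_bs_GU8n7o8tpm1o4_w3_b4_R2_ob5p2_kry1_kry2c3rel_hanK7B4D4_KN4_PR20d4_hanK8c2s_uprime)
    (hC₁ : ∃ ψ : Fock (Orb (Fin 4 ×ₗ Fin 3)), HasParity 0 ψ ∧ star ψ ⬝ᵥ ψ = 1 ∧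
      (star ψ ⬝ᵥ (totalNumber *ᵥ ψ)).re = n₁ * ((4 : ℝ) * 3) ∧
      (star ψ ⬝ᵥ (dWaveSourceOpenBoxTT' 4 3 (-1 / 4) 8 μ₁ h *ᵥ ψ)).re ≤ u₁ * ((4 : ℝ) * 3))
    (hC₂ : ∃ ψ : Fock (Orb (Fin 4 ×ₗ Fin 3)), HasParity 0 ψ ∧ star ψ ⬝ᵥ ψ = 1 ∧
      (star ψ ⬝ᵥ (totalNumber *ᵥ ψ)).re = n₂ * ((4 : ℝ) * 3) ∧
      (star ψ ⬝ᵥ (dWaveSourceOpenBoxTT' 4 3 (-1 / 4) 8 μ₂ h *ᵥ ψ)).re ≤ u₂ * ((4 : ℝ) * 3))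
    (hlt : n₁ < n₂) (hle₁ : n₁ ≤ 7 / 8) (hle₂ : 7 / 8 ≤ n₂)
    (hu : (n₂ - 7 / 8) * (u₁ + μ₁ * n₁) + (7 / 8 - n₁) * (u₂ + μ₂ * n₂) ≤ u * (n₂ - n₁)) :
    (∃ ω : InfVolFermionState 2, ω.IsTranslationInvariant ∧ ω.density = 7 / 8 ∧
      ∀ ω' : InfVolFermionState 2, ω'.IsTranslationInvariant → ω'.density = 7 / 8 →
        ω.meanEnergy (hubbardTTPrimeSourcedInteraction 1 (-1 / 4) 8 0 dWaveFormFactor h) 1 ≤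
          ω'.meanEnergy (hubbardTTPrimeSourcedInteraction 1 (-1 / 4) 8 0 dWaveFormFactor h) 1) ∧
    ∀ ω : InfVolFermionState 2, ω.IsTranslationInvariant → ω.density = 7 / 8 →
      (∀ ω' : InfVolFermionState 2, ω'.IsTranslationInvariant → ω'.density = 7 / 8 →
        ω.meanEnergy (hubbardTTPrimeSourcedInteraction 1 (-1 / 4) 8 0 dWaveFormFactor h) 1 ≤
          ω'.meanEnergy (hubbardTTPrimeSourcedInteraction 1 (-1 / 4) 8 0 dWaveFormFactor h) 1) →
      (((-1008420703687177600106633 / 1208925819614629174706176 : ℚ) : ℝ) - u) / (2 * h) ≤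
        (ω.expect (pairRegion (insert 0 unitSteps) 0) (localPairAt (insert 0 unitSteps) dWaveFormFactor 0)).re :=
  minimiser_response_floor_of_two_clusterNodesTT'_4x3 (by norm_num) hh (by norm_num) (by norm_num) h504 hC₁ hC₂ hlt
    hle₁ hle₂ hu

/-- **B1 floor reader at `t′ = 0` on node #473 BY NAME** (`cert_r473_… : lo₄₇₃ ≤ e(1,0,8,7/8)`,
`lo₄₇₃ = −1012151804787154021296135/2⁸⁰`) with two `t′ = 0` `4 × 3` cluster nodes (symbolic exact rows; the
`t–t′` cluster at `tp = 0` IS the part-3 cluster, `dWaveSourceOpenBoxTT'_zero_tp`): density-`7/8` minimisers of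
`E_h` exist and every one has `(lo₄₇₃ − u)/(2h) ≤ Re ω(P₀^d)`. [cite: Griffiths1966, §II] -/
theorem minimiser_response_floor_B1_of_cert473_of_two_clusterNodes (hh : 0 < h)
    (h473 : cert_r473_bs_M3U8tp0_w3_b4_R2_ob5p2_kry1_kry2c3rel_hanK7B4D4_KN4_PR20d4_hanK8c2s_hanK8B4D4_uprime)
    (hC₁ : ∃ ψ : Fock (Orb (Fin 4 ×ₗ Fin 3)), HasParity 0 ψ ∧ star ψ ⬝ᵥ ψ = 1 ∧
      (star ψ ⬝ᵥ (totalNumber *ᵥ ψ)).re = n₁ * ((4 : ℝ) * 3) ∧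
      (star ψ ⬝ᵥ (dWaveSourceOpenBox 4 3 8 μ₁ h *ᵥ ψ)).re ≤ u₁ * ((4 : ℝ) * 3))
    (hC₂ : ∃ ψ : Fock (Orb (Fin 4 ×ₗ Fin 3)), HasParity 0 ψ ∧ star ψ ⬝ᵥ ψ = 1 ∧
      (star ψ ⬝ᵥ (totalNumber *ᵥ ψ)).re = n₂ * ((4 : ℝ) * 3) ∧
      (star ψ ⬝ᵥ (dWaveSourceOpenBox 4 3 8 μ₂ h *ᵥ ψ)).re ≤ u₂ * ((4 : ℝ) * 3))
    (hlt : n₁ < n₂) (hle₁ : n₁ ≤ 7 / 8) (hle₂ : 7 / 8 ≤ n₂)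
    (hu : (n₂ - 7 / 8) * (u₁ + μ₁ * n₁) + (7 / 8 - n₁) * (u₂ + μ₂ * n₂) ≤ u * (n₂ - n₁)) :
    (∃ ω : InfVolFermionState 2, ω.IsTranslationInvariant ∧ ω.density = 7 / 8 ∧
      ∀ ω' : InfVolFermionState 2, ω'.IsTranslationInvariant → ω'.density = 7 / 8 →
        ω.meanEnergy (hubbardTTPrimeSourcedInteraction 1 0 8 0 dWaveFormFactor h) 1 ≤
          ω'.meanEnergy (hubbardTTPrimeSourcedInteraction 1 0 8 0 dWaveFormFactor h) 1) ∧
    ∀ ω : InfVolFermionState 2, ω.IsTranslationInvariant → ω.density = 7 / 8 →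
      (∀ ω' : InfVolFermionState 2, ω'.IsTranslationInvariant → ω'.density = 7 / 8 →
        ω.meanEnergy (hubbardTTPrimeSourcedInteraction 1 0 8 0 dWaveFormFactor h) 1 ≤
          ω'.meanEnergy (hubbardTTPrimeSourcedInteraction 1 0 8 0 dWaveFormFactor h) 1) →
      (((-1012151804787154021296135 / 1208925819614629174706176 : ℚ) : ℝ) - u) / (2 * h) ≤
        (ω.expect (pairRegion (insert 0 unitSteps) 0) (localPairAt (insert 0 unitSteps) dWaveFormFactor 0)).re := by
  have h := minimiser_response_floor_of_two_clusterNodesTT'_4x3 (tp := 0) (μ₁ := μ₁) (μ₂ := μ₂) (by norm_num) hh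
    (by norm_num) (by norm_num) h473 (by simpa only [dWaveSourceOpenBoxTT'_zero_tp] using hC₁)
    (by simpa only [dWaveSourceOpenBoxTT'_zero_tp] using hC₂) hlt hle₁ hle₂ hu
  simpa only using h

end Anchors

end Summit.Ventures.CertifiedManyBodySolver.Observables

end
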